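import Summits.QuantumFields.BalabanUV.Beta.FP.PeriodisedSymBorderWardContactTwoInstance
import Summits.QuantumFields.BalabanUV.Beta.FP.NestedDeadRowsOrderTwo

/-!
# `BalabanUV.Beta.FP.PeriodisedSymDeadRowOrderTwo` — road «FP», ROUTE T, binder row D1: **ROW `t2` OF THE (STEP) DOOR AT THE TORUS, BY TERM, FROM
# `hdead` ALONE** (memo `N2B-DESIGN.md` (31d) (β) «`t2` — leaf-06, `t1`'s twin»; R-FP-61 (i): the square-law branch is the branch of record)

WHY.  U21 `FP/NestedStepLawTorusTransportedRowsGradedLevelZeroSymULowClosedLamW2Q2` displays, per direction `h`, the ORDER-2 coarse dead row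
`t2 : τ₂ · (Q₁₂ h h · [D₂ | D₁] + 2•(Q₁₁ h · W₁) + Q₁₀ · W₂) = 0` next to the order-2 covariance row `c2 : (same word) = [D̄₂ | 0]`.  leaf-02's
`PeriodisedSymBorderWardContactTwoInstance.torus_c2_sym_weighted` makes `c2` a THEOREM of the objects of record for ANY bond weight `h`, with the
coarse second jet `D̄₂((p̄,m), t̄) = c_j³ · (Σ_b Q₁₀((p̄,m), b)·h b)² · [t̄ = p̄ + e_m]` — the SQUARE of the direction's linear average, tip-type.  My
`NestedDeadRowsOrderTwo.torus_t2_of_c2_sq` (§2 there) turns exactly that shape plus the nested chart's `hdead` (`Σ_b Q₁₀(a, b)·h b = 0` at every coarse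
comb bond `a`) into `t2`.  THIS FILE composes the two BY TERM: `t2` for any comb-dead bond weight `h`, in U21's binder shapes — the `t1` twin one order up
(`NestedStepLawTorusTransportedRowsGradedSym.torus_t1_sym_of_average_dead`).  After it the door's order-2 coarse rows `c2 ∧ t2` at the torus call are
both theorems; `d2` (re-cut as `d2′` with `Db₂ − Db₂′` on the GENERATOR side by the OWNER's R-FP-62 — leaf-02's T4 `torus_d2_sym_weighted`; the FINE-side
`t2` keeps the pure `Db₂` and is unaffected, R-FP-62 (iii)), `a1 a2` and the namings stay displayed (leaf-02 ∕ leaf-05 ∕ an2).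
* §1 **`torus_t2_sym_weighted_of_average_dead`** — level `j`, coarse residual parameters rooted at ANY `toSite r′` (the shape of `torus_c2_sym_weighted`;
  serves the composite door #21's top step as well): `hdead ⟹ t2`.
* §2 **`torus_t2_sym_of_average_dead`** — the same at the CENTRED root `ctr (3+1) Lc` (U21's literal types `Res (ctr (3+1) Lc) Lc M′`,
  `combRowsT (ctr (3+1) Lc) Lc M′`; `ctr = toSite ∘ ctrOff` by `rfl`) — ONE `exact` of §1; at `j = 0` it is U21's `t2` binder BY TERM from its `hdead` binder.
[folklore] composition BY NAME of two landed theorems; no `def`, no `def … : Prop`, nothing cited, 0 sorry; 0 estimates.  NOT HERE: `d2′` (the averaging-side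
order-2 row, leaf-02's T4), `a1 a2` (leaf-05 O-6 ∕ an2's (K1)(K1′)), the free slot `G` (R-FP-58), the composite door #21's `uTop` at `j ≥ 2` (whose coarse
generator jet reads `Db₂ − Db₂′` by R-FP-62 (iii): the square part dies under `hdead`, the `−Db₂′` part is the ONE comb scalar of my `NestedDeadRowsOrderTwo`
§3 `torus_uTop_eq_sum_of_average_dead` — priced, R-FP-56 (b)).

HONEST DEPENDENCY (page 1, mandatory): continuum YM on T⁴ ⇐ BetaPertH ∧ nine spine estimates (0/9 proved); BetaPertH ⇐ (D1) ∧ (D4) ∧ CAP+tail;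
G-an2-4 gates asym, D1 and NE2/3/4.  HONEST FRAMING (cell contract, verbatim): «discharging `BetaPertH` makes Bałaban's UV stability UNCONDITIONAL —
a real constructive-QFT result; it is NOT the continuum limit and NOT the Clay problem.»  ABSOLUTE RULE (cell charter, verbatim): «No internally-minted
statement may enter as a cited fact. Every hypothesis is either kernel-proved in this package or a verbatim quotation of a PUBLISHED theorem with page
reference. The manuscript(s) under audit are NOT citable for their own disputed steps — they are the thing under adjudication; programme-internal
(2001/route/tribunal) claims are never citable.»  0 estimates; 0∕4 row-D1 binders (hW, hR, D1Tel, D1Rep); NOT the dictionary, NOT (T-ID)∕(T-β) complete,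
NOT SDF, NOT D1, NOT BetaPertH, NOT continuum, NOT Clay.  «not in print; our bookkeeping».
Provenance: D1 formalisation swarm LEAF PROVER 06, unit b2b-balaban-beta-d1-formalise-leaf-06 gen 25, 2026-08-23.  No existing file touched.
-/

noncomputable section

open scoped BigOperators

namespace Summit.QuantumFields.BalabanUV.Beta.FP.PeriodisedSymDeadRowOrderTwo

open Finset Matrix
open Literature.MathematicalPhysics.QuantumFieldTheory.Balaban1983to89
open Literature.MathematicalPhysics.QuantumFieldTheory.Balaban1983to89.Beta
open Literature.MathematicalPhysics.QuantumFieldTheory.LatticeForm (quo)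
open B4TorusKernel.MultiPeriod (translate)
open B5Prop11Plancherel (fine)
open B6Lemma24Torus (pbox)
open ExpKernelCalculus (MKer)
open AffineAveraging (Site box toSite unitVec)
open AveragingContoursRooted (ctr ctrOff)
open OneStepResolventKernel (Fib)
open Summit.QuantumFields.BalabanUV.Beta.BorderedHessian (stepScale)
open Summit.QuantumFields.BalabanUV.Beta.DshAn1 (Dsh)
open Summit.QuantumFields.BalabanUV.Beta.SymAveragingHessianCounts (symVhSAt)
open Summit.QuantumFields.BalabanUV.Beta.SymShiftedSpread (bhKStepSh)
open Summit.QuantumFields.BalabanUV.Beta.SymSecondOrderTablesAn1 (symVh₂SAn1)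
open Summit.QuantumFields.BalabanUV.Beta.FP.KernelPeriodisationFib (Idx perF)
open Summit.QuantumFields.BalabanUV.Beta.FP.KernelPeriodisationFibLoc (dper)
open Summit.QuantumFields.BalabanUV.Beta.FP.TorusGaugeCovariance (tdelta tgrad)
open Summit.QuantumFields.BalabanUV.Beta.FP.TorusGaugeCovarianceCoarse (tgradBlock coarsePt)
open Summit.QuantumFields.BalabanUV.Beta.FP.TorusCombRows (Res combBondT combRowsT)
open Summit.QuantumFields.BalabanUV.Beta.FP.PeriodisedSymBorderWardContactTwoInstance (torus_c2_sym_weighted)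
open Summit.QuantumFields.BalabanUV.Beta.FP.NestedDeadRowsOrderTwo (torus_t2_of_c2_sq)

variable (M' : Fin (3 + 1) → ℕ) [∀ μ, NeZero (M' μ)] {Lc : ℕ} [NeZero Lc]

/-! ## §1 Row `t2` at the torus from `hdead`, any bond weight, any coarse residual root -/

/-- [folklore] **`torus_t2_sym_weighted_of_average_dead` — ROW `t2` OF U21 AT THE (III′) TORUS CALL, BY TERM, FROM `hdead` ALONE** (level `j`; `F = fine Lc M′`;
coarse residual parameters `Res (toSite r′) Lc M′`; the objects of record by their defining equations EXACTLY as in leaf-02's `torus_c2_sym_weighted` —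
`Q₁₀`, `Q₁₁ w`, `W₁₂`∕`Q₁₂ w w′`, `W₁ W₂`, `D₁ D₂` — plus the door's coarse comb slice `τ₂` (`hτ₂`) and the nested chart's average-comb-deadness `hdead`):
`τ₂ · (Q₁₂ h h · [D₂ | D₁] + 2•(Q₁₁ h · W₁) + Q₁₀ · W₂) = 0`.  Proof: `c2` (leaf-02, square-law `D̄₂`) ∘ `torus_t2_of_c2_sq` (leaf-06) with `κ := c_j³`. -/
theorem torus_t2_sym_weighted_of_average_dead {r' : Fin (3 + 1) → ℕ} (j : ℕ) (h : ↥(pbox (fine Lc M')) × Fin (3 + 1) → ℝ)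
    {Q₁₀ : Matrix (↥(pbox M') × Fin (3 + 1)) (↥(pbox (fine Lc M')) × Fin (3 + 1)) ℝ}
    (hQ₁₀ : Q₁₀ = (perF (fine Lc M') (bhKStepSh 3 Lc (Dsh Lc) j)).submatrix
        (fun a : ↥(pbox M') × Fin (3 + 1) => ((coarsePt M' Lc a.1, Sum.inr a.2) : Idx (fine Lc M') (Fib 3)))
        (fun b : ↥(pbox (fine Lc M')) × Fin (3 + 1) => ((b.1, Sum.inl b.2) : Idx (fine Lc M') (Fib 3))))
    (Q₁₁ : (↥(pbox (fine Lc M')) × Fin (3 + 1) → ℝ) → Matrix (↥(pbox M') × Fin (3 + 1)) (↥(pbox (fine Lc M')) × Fin (3 + 1)) ℝ)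
    (hQ₁₁ : ∀ w, Q₁₁ w = ∑ b : ↥(pbox (fine Lc M')) × Fin (3 + 1), w b •
        (perF (fine Lc M') (dper (fine Lc M') (symVhSAt (ctr (3 + 1) Lc) 3 Lc rfl b.2 (b.1 : Site (3 + 1))))).submatrix
          (fun a : ↥(pbox M') × Fin (3 + 1) => ((coarsePt M' Lc a.1, Sum.inr a.2) : Idx (fine Lc M') (Fib 3)))
          (fun b : ↥(pbox (fine Lc M')) × Fin (3 + 1) => ((b.1, Sum.inl b.2) : Idx (fine Lc M') (Fib 3))))
    {W₁₂ : Fin (3 + 1) → Site (3 + 1) → Fin (3 + 1) → Site (3 + 1) → MKer (3 + 1) (Fib 3)}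
    (hW₁₂ : W₁₂ = fun κ' u' κ u x z a c => ∑' n : Site (3 + 1), symVh₂SAn1 3 Lc κ u κ' (translate (fine Lc M') u' n) x z a c)
    (Q₁₂ : (↥(pbox (fine Lc M')) × Fin (3 + 1) → ℝ) → (↥(pbox (fine Lc M')) × Fin (3 + 1) → ℝ)
      → Matrix (↥(pbox M') × Fin (3 + 1)) (↥(pbox (fine Lc M')) × Fin (3 + 1)) ℝ)
    (hQ₁₂ : ∀ w w', Q₁₂ w w' = -(((Lc : ℝ) ^ (3 + 1) * stepScale 3 Lc j)⁻¹) • ∑ b : ↥(pbox (fine Lc M')) × Fin (3 + 1),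
        ∑ b' : ↥(pbox (fine Lc M')) × Fin (3 + 1), (w b * w' b') •
          (perF (fine Lc M') (dper (fine Lc M') (W₁₂ b'.2 (b'.1 : Site (3 + 1)) b.2 (b.1 : Site (3 + 1))))).submatrix
            (fun a : ↥(pbox M') × Fin (3 + 1) => ((coarsePt M' Lc a.1, Sum.inr a.2) : Idx (fine Lc M') (Fib 3)))
            (fun c : ↥(pbox (fine Lc M')) × Fin (3 + 1) => ((c.1, Sum.inl c.2) : Idx (fine Lc M') (Fib 3))))
    {W₁ : Matrix (↥(pbox (fine Lc M')) × Fin (3 + 1)) (Res (toSite r') Lc M' ⊕ Res (ctr (3 + 1) Lc) Lc (fine Lc M')) ℝ}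
    (hW₁ : W₁ = ∑ b : ↥(pbox (fine Lc M')) × Fin (3 + 1), h b •
        Matrix.of (fun (b' : ↥(pbox (fine Lc M')) × Fin (3 + 1)) (e : Res (toSite r') Lc M' ⊕ Res (ctr (3 + 1) Lc) Lc (fine Lc M')) =>
          if b' = b then
            -((((Lc : ℝ) ^ (3 + 1) * stepScale 3 Lc j)⁻¹)
              * Sum.elim (fun t : Res (toSite r') Lc M' => tdelta M' (quo Lc ((b.1 : Site (3 + 1)) + unitVec b.2)) t.1)
                  (fun s : Res (ctr (3 + 1) Lc) Lc (fine Lc M') => tdelta (fine Lc M') ((b.1 : Site (3 + 1)) + unitVec b.2) s.1) e)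
          else 0))
    {W₂ : Matrix (↥(pbox (fine Lc M')) × Fin (3 + 1)) (Res (toSite r') Lc M' ⊕ Res (ctr (3 + 1) Lc) Lc (fine Lc M')) ℝ}
    (hW₂ : W₂ = Matrix.of fun (b : ↥(pbox (fine Lc M')) × Fin (3 + 1)) (e : Res (toSite r') Lc M' ⊕ Res (ctr (3 + 1) Lc) Lc (fine Lc M')) =>
        ((((Lc : ℝ) ^ (3 + 1) * stepScale 3 Lc j)⁻¹) * h b) ^ 2 * Sum.elim (fun t : Res (toSite r') Lc M' => tdelta M' (quo Lc ((b.1 : Site (3 + 1)) + unitVec b.2)) t.1)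
          (fun s : Res (ctr (3 + 1) Lc) Lc (fine Lc M') => tdelta (fine Lc M') ((b.1 : Site (3 + 1)) + unitVec b.2) s.1) e)
    {D₁ : Matrix (↥(pbox (fine Lc M')) × Fin (3 + 1)) (Res (ctr (3 + 1) Lc) Lc (fine Lc M')) ℝ}
    (hD₁ : D₁ = (tgrad (fine Lc M')).submatrix (fun b : ↥(pbox (fine Lc M')) × Fin (3 + 1) => ((b.1, Sum.inl b.2) : Idx (fine Lc M') (Fib 3)))
        (Subtype.val : Res (ctr (3 + 1) Lc) Lc (fine Lc M') → ↥(pbox (fine Lc M'))))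
    {D₂ : Matrix (↥(pbox (fine Lc M')) × Fin (3 + 1)) (Res (toSite r') Lc M') ℝ}
    (hD₂ : D₂ = (tgradBlock M' Lc).submatrix (fun b : ↥(pbox (fine Lc M')) × Fin (3 + 1) => ((b.1, Sum.inl b.2) : Idx (fine Lc M') (Fib 3)))
        (Subtype.val : Res (toSite r') Lc M' → ↥(pbox M')))
    -- the door's coarse comb slice and the nested chart's average-comb-deadness (U21's `hτ₂` ∕ `hdead` shapes at the root `toSite r′`)
    {τ₂ : Matrix (Res (toSite r') Lc M') (↥(pbox M') × Fin (3 + 1)) ℝ}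
    (hτ₂ : τ₂ = (combRowsT (toSite r') Lc M').submatrix id (fun b : ↥(pbox M') × Fin (3 + 1) => ((b.1, Sum.inl b.2) : Idx M' (Fib 3))))
    (hdead : ∀ (a : ↥(pbox M') × Fin (3 + 1)) (x : Res (toSite r') Lc M'),
      combBondT (toSite r') Lc M' x = ((a.1, Sum.inl a.2) : Idx M' (Fib 3)) → ∑ b : ↥(pbox (fine Lc M')) × Fin (3 + 1), Q₁₀ a b * h b = 0) :
    τ₂ * (Q₁₂ h h * fromCols D₂ D₁ + (2 : ℝ) • (Q₁₁ h * W₁) + Q₁₀ * W₂) = 0 :=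
  torus_t2_of_c2_sq M' hτ₂ Q₁₀ (Q₁₁ h) (Q₁₂ h h) D₂ D₁ W₁ W₂ _
    (torus_c2_sym_weighted M' j h hQ₁₀ Q₁₁ hQ₁₁ hW₁₂ Q₁₂ hQ₁₂ hW₁ hW₂ hD₁ hD₂) h
    (fun _ => (((Lc : ℝ) ^ (3 + 1) * stepScale 3 Lc j)⁻¹) ^ 3) (fun _ _ _ _ => rfl) hdead

/-! ## §2 The same at the centred root (U21's literal types) -/

/-- [folklore] **`torus_t2_sym_of_average_dead` — ROW `t2` AT THE CENTRED ROOT `ctr (3+1) Lc`** (U21's literal types: coarse residual parameters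
`Res (ctr (3+1) Lc) Lc M′`, slice `combRowsT (ctr (3+1) Lc) Lc M′`; `ctr (3+1) Lc = toSite (ctrOff (3+1) Lc)` by `rfl`): §1 at `r′ := ctrOff (3+1) Lc`.
At `j = 0` this is U21's `t2` binder BY TERM from its `hdead` binder (the `t1` twin one order up). -/
theorem torus_t2_sym_of_average_dead (j : ℕ) (h : ↥(pbox (fine Lc M')) × Fin (3 + 1) → ℝ)
    {Q₁₀ : Matrix (↥(pbox M') × Fin (3 + 1)) (↥(pbox (fine Lc M')) × Fin (3 + 1)) ℝ}
    (hQ₁₀ : Q₁₀ = (perF (fine Lc M') (bhKStepSh 3 Lc (Dsh Lc) j)).submatrix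
        (fun a : ↥(pbox M') × Fin (3 + 1) => ((coarsePt M' Lc a.1, Sum.inr a.2) : Idx (fine Lc M') (Fib 3)))
        (fun b : ↥(pbox (fine Lc M')) × Fin (3 + 1) => ((b.1, Sum.inl b.2) : Idx (fine Lc M') (Fib 3))))
    (Q₁₁ : (↥(pbox (fine Lc M')) × Fin (3 + 1) → ℝ) → Matrix (↥(pbox M') × Fin (3 + 1)) (↥(pbox (fine Lc M')) × Fin (3 + 1)) ℝ)
    (hQ₁₁ : ∀ w, Q₁₁ w = ∑ b : ↥(pbox (fine Lc M')) × Fin (3 + 1), w b •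
        (perF (fine Lc M') (dper (fine Lc M') (symVhSAt (ctr (3 + 1) Lc) 3 Lc rfl b.2 (b.1 : Site (3 + 1))))).submatrix
          (fun a : ↥(pbox M') × Fin (3 + 1) => ((coarsePt M' Lc a.1, Sum.inr a.2) : Idx (fine Lc M') (Fib 3)))
          (fun b : ↥(pbox (fine Lc M')) × Fin (3 + 1) => ((b.1, Sum.inl b.2) : Idx (fine Lc M') (Fib 3))))
    {W₁₂ : Fin (3 + 1) → Site (3 + 1) → Fin (3 + 1) → Site (3 + 1) → MKer (3 + 1) (Fib 3)}
    (hW₁₂ : W₁₂ = fun κ' u' κ u x z a c => ∑' n : Site (3 + 1), symVh₂SAn1 3 Lc κ u κ' (translate (fine Lc M') u' n) x z a c)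
    (Q₁₂ : (↥(pbox (fine Lc M')) × Fin (3 + 1) → ℝ) → (↥(pbox (fine Lc M')) × Fin (3 + 1) → ℝ)
      → Matrix (↥(pbox M') × Fin (3 + 1)) (↥(pbox (fine Lc M')) × Fin (3 + 1)) ℝ)
    (hQ₁₂ : ∀ w w', Q₁₂ w w' = -(((Lc : ℝ) ^ (3 + 1) * stepScale 3 Lc j)⁻¹) • ∑ b : ↥(pbox (fine Lc M')) × Fin (3 + 1),
        ∑ b' : ↥(pbox (fine Lc M')) × Fin (3 + 1), (w b * w' b') •
          (perF (fine Lc M') (dper (fine Lc M') (W₁₂ b'.2 (b'.1 : Site (3 + 1)) b.2 (b.1 : Site (3 + 1))))).submatrix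
            (fun a : ↥(pbox M') × Fin (3 + 1) => ((coarsePt M' Lc a.1, Sum.inr a.2) : Idx (fine Lc M') (Fib 3)))
            (fun c : ↥(pbox (fine Lc M')) × Fin (3 + 1) => ((c.1, Sum.inl c.2) : Idx (fine Lc M') (Fib 3))))
    {W₁ : Matrix (↥(pbox (fine Lc M')) × Fin (3 + 1)) (Res (ctr (3 + 1) Lc) Lc M' ⊕ Res (ctr (3 + 1) Lc) Lc (fine Lc M')) ℝ}
    (hW₁ : W₁ = ∑ b : ↥(pbox (fine Lc M')) × Fin (3 + 1), h b •
        Matrix.of (fun (b' : ↥(pbox (fine Lc M')) × Fin (3 + 1)) (e : Res (ctr (3 + 1) Lc) Lc M' ⊕ Res (ctr (3 + 1) Lc) Lc (fine Lc M')) =>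
          if b' = b then
            -((((Lc : ℝ) ^ (3 + 1) * stepScale 3 Lc j)⁻¹)
              * Sum.elim (fun t : Res (ctr (3 + 1) Lc) Lc M' => tdelta M' (quo Lc ((b.1 : Site (3 + 1)) + unitVec b.2)) t.1)
                  (fun s : Res (ctr (3 + 1) Lc) Lc (fine Lc M') => tdelta (fine Lc M') ((b.1 : Site (3 + 1)) + unitVec b.2) s.1) e)
          else 0))
    {W₂ : Matrix (↥(pbox (fine Lc M')) × Fin (3 + 1)) (Res (ctr (3 + 1) Lc) Lc M' ⊕ Res (ctr (3 + 1) Lc) Lc (fine Lc M')) ℝ}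
    (hW₂ : W₂ = Matrix.of fun (b : ↥(pbox (fine Lc M')) × Fin (3 + 1)) (e : Res (ctr (3 + 1) Lc) Lc M' ⊕ Res (ctr (3 + 1) Lc) Lc (fine Lc M')) =>
        ((((Lc : ℝ) ^ (3 + 1) * stepScale 3 Lc j)⁻¹) * h b) ^ 2 * Sum.elim (fun t : Res (ctr (3 + 1) Lc) Lc M' => tdelta M' (quo Lc ((b.1 : Site (3 + 1)) + unitVec b.2)) t.1)
          (fun s : Res (ctr (3 + 1) Lc) Lc (fine Lc M') => tdelta (fine Lc M') ((b.1 : Site (3 + 1)) + unitVec b.2) s.1) e)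
    {D₁ : Matrix (↥(pbox (fine Lc M')) × Fin (3 + 1)) (Res (ctr (3 + 1) Lc) Lc (fine Lc M')) ℝ}
    (hD₁ : D₁ = (tgrad (fine Lc M')).submatrix (fun b : ↥(pbox (fine Lc M')) × Fin (3 + 1) => ((b.1, Sum.inl b.2) : Idx (fine Lc M') (Fib 3)))
        (Subtype.val : Res (ctr (3 + 1) Lc) Lc (fine Lc M') → ↥(pbox (fine Lc M'))))
    {D₂ : Matrix (↥(pbox (fine Lc M')) × Fin (3 + 1)) (Res (ctr (3 + 1) Lc) Lc M') ℝ}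
    (hD₂ : D₂ = (tgradBlock M' Lc).submatrix (fun b : ↥(pbox (fine Lc M')) × Fin (3 + 1) => ((b.1, Sum.inl b.2) : Idx (fine Lc M') (Fib 3)))
        (Subtype.val : Res (ctr (3 + 1) Lc) Lc M' → ↥(pbox M')))
    {τ₂ : Matrix (Res (ctr (3 + 1) Lc) Lc M') (↥(pbox M') × Fin (3 + 1)) ℝ}
    (hτ₂ : τ₂ = (combRowsT (ctr (3 + 1) Lc) Lc M').submatrix id (fun b : ↥(pbox M') × Fin (3 + 1) => ((b.1, Sum.inl b.2) : Idx M' (Fib 3))))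
    (hdead : ∀ (a : ↥(pbox M') × Fin (3 + 1)) (x : Res (ctr (3 + 1) Lc) Lc M'),
      combBondT (ctr (3 + 1) Lc) Lc M' x = ((a.1, Sum.inl a.2) : Idx M' (Fib 3)) → ∑ b : ↥(pbox (fine Lc M')) × Fin (3 + 1), Q₁₀ a b * h b = 0) :
    τ₂ * (Q₁₂ h h * fromCols D₂ D₁ + (2 : ℝ) • (Q₁₁ h * W₁) + Q₁₀ * W₂) = 0 :=
  torus_t2_sym_weighted_of_average_dead M' (r' := ctrOff (3 + 1) Lc) j h hQ₁₀ Q₁₁ hQ₁₁ hW₁₂ Q₁₂ hQ₁₂ hW₁ hW₂ hD₁ hD₂ hτ₂ hdead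

end Summit.QuantumFields.BalabanUV.Beta.FP.PeriodisedSymDeadRowOrderTwo

end
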